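import Summits.FinalStateConjecture.FinalStateConjecture.Theses.StarvedNecks
import Summits.FinalStateConjecture.FinalStateConjecture.Theorems.StarvedNecksSeamedChartsExhaust
import Summits.FinalStateConjecture.FinalStateConjecture.Theorems.StarvedNecksFutureOrientedOfSeamed
import HarnessLib

/-!
# Stub `stub_seamedAtlasSettles` of line `registered` (skeleton v2) of crux `ThriftyClusterSettling`
# (stmt-FinalStateConjecture-17611, route DerivativeThrift): a seamed atlas settles the exterior

Line `registered` (`Summits/FinalStateConjecture/FinalStateConjecture/Cruxes/ThriftyClusterSettling/Lines/
registered.lean`, skeleton v2, lead prover-line-stmt-FinalStateConjecture-17611-c1-0) composes the crux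
`Theses.DerivativeThrift.ThriftyClusterSettling` as
`stub_outerZoneFlatness → stub_thriftySeamedAtlas → stub_seamedAtlasSettles → ThriftyClusterSettling`.
This file lands the third stub, the PACKAGING step: for every admissible datum and MGHD `𝒟`, every
region `O`, `C²` final-state decomposition `d` of `O`, radii `R`, `R₀` with `O = exteriorOf 𝒟 d.charted`,
HonestCore(`d`, `R₀`) and SEAMED(`d`, `R`, `R₀`) — the certificate shape of route StarvedNecks, with the
clause families `Hc`/`Sm` `let`-bound TOKEN-IDENTICALLY to `Theses.StarvedNecks.SeamedChartsExhaust` and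
`Theses.StarvedNecks.FutureOrientedOfSeamed` — the crux's consequent holds verbatim:
`∃ O' d', (∀ i, Kerr.IsSubextremal (d'.mass i) (d'.spin i)) ∧ O' = exteriorOf 𝒟 d'.charted ∧
HasExhaustiveCharts d' ∧ IsFutureOriented d'`, witnessed by `(O, d)` itself: sub-extremality is
HonestCore (a), exhaustion is the PROVED crux `StarvedNecks.SeamedChartsExhaust`
(`Theorems.SeamedChartsExhaust.WideAnchoring.seamedChartsExhaust`, stmt-FinalStateConjecture-13551) and
orientation the PROVED crux `StarvedNecks.FutureOrientedOfSeamed`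
(`Theorems.FutureOrientedOfSeamed.ClockDualityRays.FutureOrientedOfSeamed_of`,
stmt-FinalStateConjecture-17576).  Why this is the line's last step (wave-1 finding, `Lines/registered.md`):
the birth cut's a-posteriori seam of two independently certified flat charts is not derivable (no
frame/placement tie between two rate-free certificates), so the seam lives in the analytic stub and the
last step is packaging over the tree's landed seam technology, which starts from ONE flat chart on the
late half-space.

References: B. O'Neill, *Semi-Riemannian geometry*, 1983, Ch. 14, pp. 402–403 (causality of the
exterior); Dafermos–Holzegel–Rodnianski–Taylor, arXiv:2104.08222, §1 (chart / deviation vocabulary).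
-/

noncomputable section

-- the doubled `FinalStateConjecture` path component is the summit/problem naming scheme
set_option linter.dupNamespace false

namespace Summit.FinalStateConjecture.FinalStateConjecture.Theorems.DerivativeThrift.ThriftyClusterSettling

open Set Filter Topology TopologicalSpace
open scoped Manifold ContDiff ENNReal
open Literature.Geometry.Lorentzian

/-- **A seamed atlas settles the exterior (stub `stub_seamedAtlasSettles` of line `registered`, crux
`DerivativeThrift.ThriftyClusterSettling`).**  For every admissible datum, MGHD `𝒟`, region `O`, `C²`
decomposition `d` of `O`, radii `R`, `R₀`: `O = exteriorOf 𝒟 d.charted`, HonestCore(`d`, `R₀`) and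
SEAMED(`d`, `R`, `R₀`) (the `Hc`/`Sm` clause texts of `Theses.StarvedNecks.SeamedChartsExhaust`, token for
token) give a sub-extremal, honest, exhaustive, future-oriented decomposition — `(O, d)` itself:
sub-extremality is HonestCore (a); `HasExhaustiveCharts d` is
`Theorems.SeamedChartsExhaust.WideAnchoring.seamedChartsExhaust`; `IsFutureOriented d` is
`Theorems.FutureOrientedOfSeamed.ClockDualityRays.FutureOrientedOfSeamed_of`.  O'Neill 1983, Ch. 14,
pp. 402–403; DHRT arXiv:2104.08222, §1. -/
theorem stub_seamedAtlasSettles : let Hc := ( fun (𝓢 : Spacetime.{0} 4) (O : Set 𝓢.carrier) (k : ℕ) (d : FinalStateDecomposition 𝓢 O k) (R₀ : ℝ) => let B := d.background; let t := fun i ↦ (B i).time; let r := fun i ↦ (B i).radius; let Ψ := d.chart; (∀ i, Kerr.IsSubextremal (d.mass i) (d.spin i) ∧ 100 * d.mass i ≤ R₀ ∧ 0 < ((d.motion i).1 : E4 ≃L[ℝ] E4) (E4.basisVector 0) 0) ∧ (∀ i (ϱ τ₂ : ℝ), R₀ ≤ ϱ → d.τ₀ < τ₂ → Ψ i '' {x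 | d.τ₀ < t i x.1 ∧ t i x.1 < τ₂ ∧ r i x.1 < ϱ} ⊆ 𝓢.metric.causalPast 𝓢.timeOrientation (Ψ i '' (B i).truncTimeSlab ϱ τ₂)) ∧ (∀ i (τ' : ℝ) (ϱ : ℝ → ℝ), Continuous ϱ → d.τ₀ < τ' → let A := Ψ i '' {x | τ' ≤ t i x.1 ∧ r i x.1 ≤ ϱ (t i x.1)}; closure A ∩ O ⊆ A) ∧ (∀ y : d.flatDomain, d.τ₀ < y.1 0 → 𝓢.timeOrientation.IsFutureDirected (mfderiv 𝓘(ℝ, E4) (𝓡 4) d.flatChart y (E4.basisVector 0))) ); let Sm := ( fun (𝓢 : Spacetime.{0} 4) (O : Set 𝓢.carrier) (d : FinalStateDecomposition 𝓢 O 2) (R : Fin d.N → ℝ → ℝ) (R₀ : ℝ) => let B := d.background; let t := fun i ↦ (B i).time; let r := fun i ↦ (B i).radius; let Λ := fun i ↦ ((d.motion i).1 : E4 ≃L[ℝ] E4); let Φ := d.flatChart; let Ψ := d.chart; let ρ := d.excision; (∀ i, Monotone (R i) ∧ Continuous (R i) ∧ ∀ s, R₀ + 4 ≤ R i s ∧ R₀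 ≤ ρ i s) ∧ (∀ i, Tendsto (fun τ ↦ 𝓢.truncDeviationCk (B i) (Ψ i) 2 (R i τ) τ) atTop (𝓝 0)) ∧ supCkENorm (Subtype.val '' {y : d.flatDomain | d.τ₀ ≤ y.1 0}) 0 (𝓢.deviationExtend (Minkowski.backgroundOn d.flatDomain) Φ) ≤ 10⁻¹ ∧ (∀ i, supCkENorm (Subtype.val '' {x : (B i).domain | (d.τ₀ ≤ t i x.1 ∨ d.τ₀ ≤ x.1 0) ∧ R₀ ≤ r i x.1 ∧ r i x.1 ≤ R i (t i x.1)}) 0 (𝓢.deviationExtend (B i) (Ψ i)) ≤ ENNReal.ofReal (1 / (10 * ‖(Λ i : E4 →L[ℝ] E4)‖ ^ 2))) ∧ (∀ i (x : (B i).domain), (d.τ₀ ≤ t i x.1 ∨ d.τ₀ ≤ x.1 0) → R₀ ≤ r i x.1 → r i x.1 ≤ R i (t i x.1) → 𝓢.timeOrientation.IsFutureDirected (mfderiv 𝓘(ℝ, E4) (𝓡 4) (Ψ i) x ((Λ i) (E4.basisVector 0)))) ∧ (∀ i (y : E4) (hy : y ∈ (B i).domain), d.τ₀ ≤ y 0 →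 (∀ j, ρ j (y 0) < r j y) → r i y ≤ R i (t i y) + 1 → ∃ hy' : y ∈ d.flatDomain, Ψ i ⟨y, hy⟩ = Φ ⟨y, hy'⟩) ∧ (∀ y : d.flatDomain, d.τ₀ ≤ y.1 0 → ∀ j, ρ j (y.1 0) < r j y.1) ∧ (∀ j (y : E4), d.τ₀ ≤ y 0 → r j y ≤ ρ j (y 0) → r j y + 2 ≤ R j (t j y)) ∧ (∀ j (y : E4), d.τ₀ ≤ t j y → r j y ≤ R j (t j y) + 2 → t j y ≤ y 0) ∧ (∀ j, Ψ j '' {x | d.τ₀ < t j x.1 ∧ R j (t j x.1) + 1 < r j x.1} ⊆ d.radiationZone) ∧ (∀ τ' : ℝ, d.τ₀ < τ' → closure (Φ '' {y | τ' ≤ y.1 0}) ⊆ Φ '' {y | τ' ≤ y.1 0} ∪ ⋃ j, Ψ j '' {x | τ' ≤ x.1 0 ∧ r j x.1 = ρ j (x.1 0)}) ∧ (∀ j j' (y : E4), j ≠ j' → (d.τ₀ ≤ y 0 ∨ d.τ₀ ≤ t j y) → r j y ≤ R j (t j y) + 1 → R j' (t j' y) + 1 < r j' y) ); ∀ (X :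 Type) [TopologicalSpace X] [ChartedSpace E3 X] [IsManifold (𝓡 3) ∞ X] [T2Space X] [SecondCountableTopology X] [ConnectedSpace X] (D : InitialDataSet (𝓡 3) X), D ∈ admissibleVacuumData X → ∀ 𝒟 : VacuumCauchyDevelopment D, 𝒟.IsMaximal → ∀ (O : Set 𝒟.carrier) (d : FinalStateDecomposition 𝒟.toSpacetime O 2) (R : Fin d.N → ℝ → ℝ) (R₀ : ℝ), O = exteriorOf 𝒟.toCauchyDevelopment d.charted → Hc 𝒟.toSpacetime O 2 d R₀ → Sm 𝒟.toSpacetime O d R R₀ → ∃ (O' : Set 𝒟.carrier) (d' : FinalStateDecomposition 𝒟.toSpacetime O' 2), (∀ i, Kerr.IsSubextremal (d'.mass i) (d'.spin i)) ∧ O' = exteriorOf 𝒟.toCauchyDevelopment d'.charted ∧ HasExhaustiveCharts d' ∧ IsFutureOriented d' := by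
  intro Hc Sm X _ _ _ _ _ _ D hD 𝒟 h𝒟 O d R R₀ hO hc hs
  have hex :=
    _root_.Summit.FinalStateConjecture.FinalStateConjecture.Theorems.SeamedChartsExhaust.WideAnchoring.seamedChartsExhaust
  have hfo :=
    _root_.Summit.FinalStateConjecture.FinalStateConjecture.Theorems.FutureOrientedOfSeamed.ClockDualityRays.FutureOrientedOfSeamed_of
  dsimp only [Theses.StarvedNecks.SeamedChartsExhaust] at hex
  dsimp only [Theses.StarvedNecks.FutureOrientedOfSeamed] at hfo
  exact ⟨O, d, fun i ↦ (hc.1 i).1, hO, hex X D hD 𝒟 h𝒟 O d R R₀ hO hc hs,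
    hfo X D hD 𝒟 h𝒟 O d R R₀ hO hc hs⟩

end Summit.FinalStateConjecture.FinalStateConjecture.Theorems.DerivativeThrift.ThriftyClusterSettling

end
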